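import Summits.KontsevichZagierPeriods.KontsevichZagierPeriods.Theses.FurushoPentagon
import Summits.KontsevichZagierPeriods.KontsevichZagierPeriods.Theorems.FurushoPentagonPentagonInKZShuffleProductAux
import Literature.NumberTheory.Transcendental.KZSemiCanonicalReductionProofs
import Literature.NumberTheory.Transcendental.KZLogCalculusProofs
import Literature.NumberTheory.Transcendental.KZProductIdeal

/-!
# `PentagonInKZ`, line `logfree-gauge-corner-flatness`: shuffle = dissection

Stub `stub_shuffleProduct` of the crux `PentagonInKZ` (stmt-KontsevichZagierPeriods-11348, route
FurushoPentagon), at the level of CLASSES in the Kontsevich–Zagier calculus: for the path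
simplices `I p u = [Δ_u(β), ∏ dtᵢ/(tᵢ - s(uᵢ))]`, `I p v` (words `u`, `v` not ending in the
letter `0`), `[I p u] · [I p v] − Σ_{w ∈ u ш v} [I p w] ∈ KZ.relations`.

Proof (`ShuffleProduct.shuffle_dissection`).  `[I u] · [I v]` is the Fubini product
`[Δ_u × Δ_v, f_u ⊗ f_v]` (`KZ.of_mul_of`, `KZ.IntegralRep.prod_integrand_eq`).  Off the null
walls `{z_a = z_b}` (`volume_setOf_apply_eq`) the product of the two ordered simplices is the
disjoint union, over the colourings `c` of the `|u| + |v|` merged positions with `|u|` positions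
coloured `true`, of the cells `C_c = {z | z ∘ e_c strictly decreasing}`, `e_c` the block
bijection of `c` (support file `FurushoPentagonPentagonInKZShuffleProductAux.lean`:
`exists_blockEquiv`, `blockEquiv_unique`): cover by sorting (`exists_strictAnti_perm`,
`exists_colouring`), disjointness by uniqueness of the decreasing rearrangement
(`colouring_eq_of_strictAnti`); each cell is the coordinate permutation `e_c` of the simplex
`Δ_w(β)` of the merged word `w ∈ u ш v` of `c`, carrying the interleaved integrand
(`exists_cellRep`: one change-of-variables move, `KZ.of_sub_of_reindex_mem_relations`).
Iterated domain additivity (`KZ.of_sub_sum_of_mem_relations`) and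
`Σ_c [I (w_c)] = Σ_{w ∈ u ш v} [I w]` (`ShuffleProduct.sum_word_subtype`) conclude.  No
definition and no notation is introduced.

References: M. Kontsevich, D. Zagier, *Periods* (2001), §1.2 (rules 1, 2); M. Eie, *The Theory
of Multiple Zeta Values with Applications in Combinatorics* (2013), §1.2.
-/

noncomputable section

open Set MeasureTheory
open Literature.NumberTheory.Transcendental

namespace Summit.KontsevichZagierPeriods.FurushoPentagon.PentagonInKZ

namespace ShuffleProduct

/-! ## Null walls, sorting, cells -/

/-- A diagonal hyperplane `{z_a = z_b}` (`a ≠ b`) is Lebesgue-null (a proper linear subspace).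
[folklore] -/
theorem volume_setOf_apply_eq {N : ℕ} {a b : Fin N} (hab : a ≠ b) :
    volume {z : Fin N → ℝ | z a = z b} = 0 := by
  -- adapted from `HoffmanRelationInKZ.volume_setOf_apply_zero_eq`
  -- (Theorems/FurushoPentagonHoffmanRelationInKZShuffleCells.lean)
  let L : (Fin N → ℝ) →ₗ[ℝ] ℝ :=
    LinearMap.proj (R := ℝ) (φ := fun _ : Fin N => ℝ) a -
      LinearMap.proj (R := ℝ) (φ := fun _ : Fin N => ℝ) b
  have hL : ∀ y, L y = y a - y b := fun y => rfl
  have hset : {z : Fin N → ℝ | z a = z b} = (LinearMap.ker L : Set (Fin N → ℝ)) := by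
    ext y
    simp [hL, sub_eq_zero]
  rw [hset]
  refine Measure.addHaar_submodule volume (LinearMap.ker L) fun htop => ?_
  have hmem : (Pi.single a 1 : Fin N → ℝ) ∈ LinearMap.ker L := htop ▸ Submodule.mem_top
  rw [LinearMap.mem_ker, hL, Pi.single_eq_same, Pi.single_eq_of_ne hab.symm, sub_zero] at hmem
  exact one_ne_zero hmem

/-- A tuple with distinct entries is strictly decreasing along some permutation. [folklore] -/
theorem exists_strictAnti_perm {N : ℕ} {z : Fin N → ℝ} (hz : Function.Injective z) :
    ∃ ρ : Fin N ≃ Fin N, StrictAnti fun k => z (ρ k) := by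
  refine ⟨Fin.revPerm.trans (Tuple.sort z), fun a b hab => ?_⟩
  have hmono : StrictMono (z ∘ Tuple.sort z) :=
    (Tuple.monotone_sort z).strictMono_of_injective (hz.comp (Tuple.sort z).injective)
  simpa only [Equiv.trans_apply, Fin.revPerm_apply, Function.comp_apply] using
    hmono (Fin.rev_lt_rev.2 hab)

/-- A strictly increasing self-map of `Fin N` is the identity. [folklore] -/
theorem strictMono_eq_id {N : ℕ} {f : Fin N → Fin N} (hf : StrictMono f) : f = id :=
  (Finset.orderEmbOfFin_unique (Finset.card_fin N) (fun _ => Finset.mem_univ _) hf).trans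
    (Finset.orderEmbOfFin_unique (Finset.card_fin N) (fun _ => Finset.mem_univ _)
      strictMono_id).symm

/-- **Disjointness of the cells**: two colourings of the merged positions, read off two
permutations (`true` ↔ first block) which both sort the same tuple decreasingly, coincide (the
decreasing rearrangement is unique). [folklore] -/
theorem colouring_eq_of_strictAnti {n m : ℕ} {c c' : Fin (n + m) → Bool}
    (e e' : Fin (n + m) ≃ Fin (n + m)) (h₃ : ∀ k, c k = true ↔ (e k : ℕ) < n)
    (h₃' : ∀ k, c' k = true ↔ (e' k : ℕ) < n) {z : Fin (n + m) → ℝ}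
    (hz : StrictAnti fun k => z (e k)) (hz' : StrictAnti fun k => z (e' k)) : c = c' := by
  have hπ : StrictMono fun k => e.symm (e' k) := by
    intro k k' hkk'
    have h2 : (fun k => z (e k)) (e.symm (e' k')) < (fun k => z (e k)) (e.symm (e' k)) := by
      simpa only [Equiv.apply_symm_apply] using hz' hkk'
    exact hz.lt_iff_gt.1 h2
  have hid := strictMono_eq_id hπ
  funext k
  have hk : e' k = e k := by
    have h1 : e (e.symm (e' k)) = e k := congrArg e (congrFun hid k)
    rwa [Equiv.apply_symm_apply] at h1
  rw [Bool.eq_iff_iff, h₃, h₃', hk]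

/-- **The colouring of a permutation**: "merged position `k` carries a first-block coordinate".
[folklore] -/
theorem exists_colouring {n m : ℕ} (ρ : Fin (n + m) ≃ Fin (n + m)) :
    ∃ c : Fin (n + m) → Bool, (Finset.univ.filter (fun k => c k = true)).card = n ∧
      ∀ k, c k = true ↔ (ρ k : ℕ) < n := by
  classical
  refine ⟨fun k => decide ((ρ k : ℕ) < n), ?_, fun k => by simp⟩
  have hinj : Function.Injective fun i : Fin n => ρ.symm (Fin.castAdd m i) :=
    fun i i' h => Fin.castAdd_injective _ _ (ρ.symm.injective h)
  have hS : (Finset.univ.filter fun k => decide ((ρ k : ℕ) < n) = true) =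
      Finset.univ.map ⟨_, hinj⟩ := by
    ext k
    simp only [Finset.mem_filter, Finset.mem_univ, true_and, decide_eq_true_eq, Finset.mem_map,
      Function.Embedding.coeFn_mk]
    constructor
    · intro hk
      refine ⟨⟨ρ k, hk⟩, ?_⟩
      rw [Equiv.symm_apply_eq]
      ext; rfl
    · rintro ⟨i, rfl⟩
      simp
  rw [hS, Finset.card_map, Finset.card_fin]

/-- **The cell representation**: the simplex representation `[Δ(β), ∏ 1/(tᵢ - aᵢ)]` read along a
coordinate permutation `e` (one change-of-variables move, `KZ.of_sub_of_reindex_mem_relations`)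
lives on the cell `{z | z ∘ e ∈ Δ(β)}` with the permuted integrand.
[cite: KontsevichZagier2001, §1.2 rule (2)] -/
theorem exists_cellRep {k N : ℕ} (hk : k = N) (β : ℝ) (ρ : KZ.IntegralRep k) (a : Fin N → ℝ)
    (e : Fin N ≃ Fin N) (hd : ρ.domain = {t | (∀ i, 0 < t i ∧ t i < β) ∧ StrictAnti t})
    (hi : EqOn ρ.integrand (fun t => ∏ i, 1 / (t i - a (Fin.cast hk i))) ρ.domain) :
    ∃ R : KZ.IntegralRep N, KZ.of R - KZ.of ρ ∈ KZ.relations ∧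
      R.domain = {z | (∀ i, 0 < z (e i) ∧ z (e i) < β) ∧ StrictAnti fun i => z (e i)} ∧
      ∀ z ∈ R.domain, R.integrand z = ∏ i, 1 / (z (e i) - a i) := by
  subst hk
  refine ⟨ρ.reindex e, ?_, ?_, fun z hz => ?_⟩
  · rw [← neg_sub]
    exact KZ.relations.neg_mem (KZ.of_sub_of_reindex_mem_relations ρ e)
  · rw [KZ.IntegralRep.reindex_domain, hd]
    rfl
  · rw [KZ.IntegralRep.reindex_domain] at hz
    rw [KZ.IntegralRep.reindex_integrand]
    simp only
    rw [hi hz]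
    simp

/-- **Shuffle = dissection** for simplex representations with bound `β` and pole positions `s`:
`[J u] · [J v] − Σ_{w ∈ u ш v} [J w] ∈ KZ.relations` for words `u`, `v` not ending in `0`.
[cite: Eie2013, §1.2] -/
theorem shuffle_dissection (β : ℝ) (s : Fin 3 → ℝ)
    (J : (w : List (Fin 3)) → KZ.IntegralRep w.length)
    (hJ : ∀ w : List (Fin 3), w.getLast? ≠ some 0 →
      (J w).domain = {t | (∀ i, 0 < t i ∧ t i < β) ∧ StrictAnti t} ∧
      EqOn (J w).integrand (fun t => ∏ i, 1 / (t i - s (w.get i))) (J w).domain)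
    (u v : List (Fin 3)) (hu : u.getLast? ≠ some 0) (hv : v.getLast? ≠ some 0) :
    KZ.of (J u) * KZ.of (J v) - ((MZV.shuffleWord u v).map fun w => KZ.of (J w)).sum ∈
      KZ.relations := by
  classical
  -- the merged words `W c` of the colourings `c` and their block bijections `e c`
  obtain ⟨W, hW⟩ : ∃ W : (Fin (u.length + v.length) → Bool) → List (Fin 3), ∀ c,
      W c = List.ofFn (fun k => if c k = true
        then u.getD (Finset.univ.filter (fun k' => k' < k ∧ c k' = true)).card 0
        else v.getD (Finset.univ.filter (fun k' => k' < k ∧ c k' = false)).card 0) :=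
    ⟨_, fun c => rfl⟩
  choose e he₁ he₂ he₃ he₄ he₅ using
    fun c : {c : Fin (u.length + v.length) → Bool //
      (Finset.univ.filter (fun k => c k = true)).card = u.length} =>
      exists_blockEquiv u v W hW c.1 c.2
  -- the cells
  have hcell : ∀ c : {c : Fin (u.length + v.length) → Bool //
      (Finset.univ.filter (fun k => c k = true)).card = u.length},
      ∃ R : KZ.IntegralRep (u.length + v.length),
        KZ.of R - KZ.of (J (W c.1)) ∈ KZ.relations ∧
        R.domain = {z | (∀ k, 0 < z (e c k) ∧ z (e c k) < β) ∧ StrictAnti fun k => z (e c k)} ∧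
        ∀ z ∈ R.domain, R.integrand z = ∏ k, 1 / (z (e c k) - s ((W c.1).getD k 0)) := by
    intro c
    have hlast : (W c.1).getLast? ≠ some 0 := by
      rcases MZV.getLast?_of_mem_shuffleWord u v (word_mem_shuffleWord u v W hW c.1 c.2) with
        h | h <;> rw [h]
      · exact hu
      · exact hv
    have hlen : (W c.1).length = u.length + v.length := by rw [hW]; exact List.length_ofFn
    obtain ⟨hd, hi⟩ := hJ _ hlast
    exact exists_cellRep hlen β (J (W c.1)) (fun k => s ((W c.1).getD k 0)) (e c) hd
      fun t ht => by rw [hi ht]; simp only [Fin.val_cast, List.getD_eq_get]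
  choose R hRJ hRd hRi using hcell
  -- the product representation
  have hrd : ∀ z, z ∈ ((J u).prod (J v)).domain ↔
      (fun i => z (Fin.castAdd v.length i)) ∈
          {t : Fin u.length → ℝ | (∀ i, 0 < t i ∧ t i < β) ∧ StrictAnti t} ∧
        (fun j => z (Fin.natAdd u.length j)) ∈
          {t : Fin v.length → ℝ | (∀ i, 0 < t i ∧ t i < β) ∧ StrictAnti t} := by
    intro z
    rw [KZ.IntegralRep.prod_domain, KZ.IntegralRep.mem_prodDomain, (hJ u hu).1, (hJ v hv).1]
  have hri : ∀ z ∈ ((J u).prod (J v)).domain, ((J u).prod (J v)).integrand z =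
      (∏ i, 1 / (z (Fin.castAdd v.length i) - s (u.get i))) *
        ∏ j, 1 / (z (Fin.natAdd u.length j) - s (v.get j)) := by
    intro z hz
    rw [KZ.IntegralRep.prod_domain, KZ.IntegralRep.mem_prodDomain] at hz
    rw [KZ.IntegralRep.prod_integrand_eq, KZ.IntegralRep.prodFun_apply, (hJ u hu).2 hz.1,
      (hJ v hv).2 hz.2]
  -- geometry of the cells: inside the product, pairwise disjoint, covering off the walls
  have hsub : ∀ c, (R c).domain ⊆ ((J u).prod (J v)).domain := by
    intro c z hz
    rw [hRd] at hz
    obtain ⟨hcube, hanti⟩ := hz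
    rw [hrd]
    refine ⟨⟨fun i => ?_, fun i i' h => ?_⟩, ⟨fun j => ?_, fun j j' h => ?_⟩⟩
    · simpa only [Equiv.apply_symm_apply] using hcube ((e c).symm (Fin.castAdd v.length i))
    · simpa only [Equiv.apply_symm_apply] using hanti (he₁ c h)
    · simpa only [Equiv.apply_symm_apply] using hcube ((e c).symm (Fin.natAdd u.length j))
    · simpa only [Equiv.apply_symm_apply] using hanti (he₂ c h)
  have hdisj : ∀ c c', c ≠ c' → Disjoint (R c).domain (R c').domain := by
    intro c c' hne
    rw [hRd, hRd]
    exact Set.disjoint_left.2 fun z hz hz' =>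
      hne (Subtype.ext (colouring_eq_of_strictAnti (e c) (e c') (he₃ c) (he₃ c') hz.2 hz'.2))
  have hcov : ((J u).prod (J v)).domain \ (⋃ c, (R c).domain) ⊆
      ⋃ p : {p : Fin (u.length + v.length) × Fin (u.length + v.length) // p.1 ≠ p.2},
        {z | z p.1.1 = z p.1.2} := by
    rintro z ⟨hzD, hzU⟩
    by_contra hw
    simp only [mem_iUnion, mem_setOf_eq, not_exists] at hw
    have hinj : Function.Injective z := fun a b hab => by
      by_contra hne
      exact hw ⟨(a, b), hne⟩ hab
    apply hzU
    obtain ⟨ρ, hρ⟩ := exists_strictAnti_perm hinj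
    obtain ⟨⟨hxc, hxa⟩, ⟨hyc, hya⟩⟩ := (hrd z).1 hzD
    obtain ⟨c, hc, hcρ⟩ := exists_colouring ρ
    have hρ₁ : StrictMono fun i => ρ.symm (Fin.castAdd v.length i) := fun i i' hii' =>
      hρ.lt_iff_gt.1 (by simpa only [Equiv.apply_symm_apply] using hxa hii')
    have hρ₂ : StrictMono fun j => ρ.symm (Fin.natAdd u.length j) := fun j j' hjj' =>
      hρ.lt_iff_gt.1 (by simpa only [Equiv.apply_symm_apply] using hya hjj')
    have heρ : e ⟨c, hc⟩ = ρ :=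
      blockEquiv_unique c hc _ ρ (he₁ ⟨c, hc⟩) (he₂ ⟨c, hc⟩) (he₃ ⟨c, hc⟩) hρ₁ hρ₂ hcρ
    refine mem_iUnion.2 ⟨⟨c, hc⟩, ?_⟩
    rw [hRd, heρ]
    exact ⟨fun k => Fin.addCases (motive := fun a => 0 < z a ∧ z a < β) (fun i => hxc i)
      (fun j => hyc j) (ρ k), hρ⟩
  have hnull : volume (((J u).prod (J v)).domain \ ⋃ c, (R c).domain) = 0 :=
    measure_mono_null hcov (measure_iUnion_null_iff.2 fun p => volume_setOf_apply_eq p.2)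
  have hint : ∀ c, EqOn (R c).integrand ((J u).prod (J v)).integrand
      ((R c).domain ∩ ((J u).prod (J v)).domain) := by
    rintro c z ⟨hz, hz'⟩
    rw [hRi _ z hz, hri z hz',
      ← (e c).symm.prod_comp fun k => 1 / (z (e c k) - s ((W c.1).getD k 0)), Fin.prod_univ_add]
    simp only [Equiv.apply_symm_apply, he₄, he₅]
  -- iterated domain additivity, the cells, and the count of the interleavings
  have h1 : KZ.of ((J u).prod (J v)) - ∑ c, KZ.of (R c) ∈ KZ.relations :=
    KZ.of_sub_sum_of_mem_relations Finset.univ _ R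
      (fun c _ => by rw [Set.sdiff_eq_empty.2 (hsub c), measure_empty])
      (fun c _ => hint c)
      (by simpa only [Finset.mem_univ, iUnion_true] using hnull)
      (fun c _ c' _ hne => by
        show volume ((R c).domain ∩ (R c').domain) = 0
        rw [(hdisj c c' hne).inter_eq, measure_empty])
  have h2 : ∑ c, (KZ.of (R c) - KZ.of (J (W c.1))) ∈ KZ.relations := sum_mem fun c _ => hRJ c
  rw [KZ.of_mul_of, ← sum_word_subtype u v W hW (fun w => KZ.of (J w))]
  have : KZ.of ((J u).prod (J v)) - ∑ c : {c : Fin (u.length + v.length) → Bool //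
        (Finset.univ.filter (fun k => c k = true)).card = u.length}, KZ.of (J (W c.1)) =
      (KZ.of ((J u).prod (J v)) - ∑ c, KZ.of (R c)) + ∑ c, (KZ.of (R c) - KZ.of (J (W c.1))) := by
    rw [Finset.sum_sub_distrib]
    abel
  rw [this]
  exact KZ.relations.add_mem h1 h2

end ShuffleProduct

open ShuffleProduct in
/-- **Stub `stub_shuffleProduct`** [M]: SHUFFLE = DISSECTION for the path simplices, at the
level of classes: for two words `u, v` not ending in the letter `0`, the Fubini product of the two
simplex representations minus the sum of the representations of the shuffled words lies in
`KZ.relations` (the product `Δ_u × Δ_v` is, up to the null tie-walls, the disjoint union over the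
interleavings `w ∈ u ш v` of cells that are coordinate permutations of the simplex `Δ_w`, with the
interleaved integrand: moves (1a) domain additivity, (2) `KZ.of_sub_of_reindex_mem_relations`, and
`KZ.of_mem_relations_of_volume_eq_zero` for the walls). [cite: Eie2013, §1.2] -/
theorem stub_shuffleProduct :
    ∀ (I : (p : Fin 15) → (w : List (Fin 3)) → KZ.IntegralRep w.length), (∀ (p : Fin 15) (w : List (Fin 3)), w.getLast? ≠ some 0 → (I p w).domain = {t | (∀ i, 0 < t i ∧ t i < (![1/2, 1/2, 1/2, 1/2, 1/2, 1/2, 1/2, 1/2, 1/2, 1/2, 1, 1, 1/2, 1/2, 1/2] : Fin 15 → ℝ) p) ∧ StrictAnti t} ∧ Set.EqOn (I p w).integrand (fun t => ∏ i, 1 / (t i - (![![0, 1, 2], ![0, 1, -1], ![0, 1, 2], ![0, 1, -1], ![0, 1, 2], ![0, 1, 2], ![0, 1, 2], ![0, 1, 2], ![0, 1, 2], ![0, 1, 2], ![0, -1, 2], ![0, -1, 2], ![0, 1, 2], ![0, 1, 2], ![0, 1, 2]] : Fin 15 → Fin 3 → ℝ) p (w.get i))) (I p w).domain) → (∀ (p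 : Fin 15) (u v : List (Fin 3)), u.getLast? ≠ some 0 → v.getLast? ≠ some 0 → KZ.of (I p u) * KZ.of (I p v) - ((MZV.shuffleWord u v).map (fun w => KZ.of (I p w))).sum ∈ KZ.relations) := by
  intro I hI p u v hu hv
  exact shuffle_dissection _ _ (fun w => I p w) (fun w hw => hI p w hw) u v hu hv

end Summit.KontsevichZagierPeriods.FurushoPentagon.PentagonInKZ
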